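import Summits.AtomisticToContinuum.FouriersLaw.Theorems.HonestZwanzigPositiveMemoryUpperLimit
import Summits.AtomisticToContinuum.FouriersLaw.Theorems.HonestZwanzigNetworkReductionLimits

/-!
# HonestZwanzig / PositiveMemory — `OrthogonalOhm` implies the bulk backflow floor (line `Sketch`, Stub BO)

Support file for item `stmt-AtomisticToContinuum-12694` (`PositiveMemory` of route `HonestZwanzig`, sub-problem
`FouriersLaw`), line `Sketch` v8, registered stub `stub_backflowFloor_of_orthogonalOhm`:
`FeshbachIdentities → (Kirchhoff flatness) → OrthogonalOhm → BulkBackflowFloor`.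

Proof (pure bookkeeping): fix the parameters, `T` and `δ > 0`; let `k, C` be the Ohm data of `OrthogonalOhm`
and `R₁ := R(ε)` its bulk depth at `ε := δ/4`; choose once, for every `N ≥ 2`, the orthogonal-dynamics DC
responses `ρ_b = lim_{s↓0} schur_s(j_b, J)` on the genuine bonds (`ρ := 0` on the phantom index). Then
`|ρ_b − k| ≤ C + |k|` everywhere and `≤ ε` on the `R₁`-bulk bonds, so
`Σ_b ρ_b ≤ N k + N ε + (2R₁+1)(C+|k|)` (`sum_abs_le_of_bulk`), while `∫₀^∞corr(J,J) ≤ Σ_b ρ_b`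
(`stub_upperLimit`, landed). Take `R := max R₁ M` with `M ε ≥ (2R₁+1)(C+|k|) + |k|`. On an `R`-bulk bond of
the `N`-chain (`N ≥ M + 2`): the unprojected limit is `ℓ = ∫₀^∞corr(J,J)/(N−1)` (Kirchhoff flatness and
uniqueness of limits in `𝓝[>] 0`), hence `ℓ (N−1) ≤ (N−1)(k + 2ε)`, i.e. `ℓ ≤ k + 2ε`; the projected limit is
the Ohm response (uniqueness of limits), hence `ρ ≥ k − ε ≥ ℓ − 3ε ≥ ℓ − δ`.
-/

noncomputable section

open MeasureTheory Finset Real Set Filter Topology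
open Literature.MathematicalPhysics.KineticTheory.HeatConduction
open Summit.AtomisticToContinuum.FouriersLaw.Theorems.HonestZwanzig.NetworkReduction

namespace Summit.AtomisticToContinuum.FouriersLaw.Theorems.HonestZwanzig.PositiveMemory

/-- **Stub BO — `OrthogonalOhm` implies the bulk backflow floor** (registered v8; bookkeeping):
given Kirchhoff flatness (Stub R) the unprojected limit on any genuine bond is `ℓ = ∫₀^∞corr(J,J)/(N−1)`, and along the
orthogonal-dynamics responses of `OrthogonalOhm` (chosen once at `ε = δ/4`, bulk depth `R₁`),
`∫₀^∞corr(J,J) ≤ Σ_b ρ_b` (`stub_upperLimit`, landed) `≤ N k + N ε + (2R₁+1)(C + |k|)` (`sum_abs_le_of_bulk`), so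
`ℓ ≤ k + 2ε` once `N − 1 ≥ M + 1` with `M ε ≥ (2R₁+1)(C+|k|) + |k|`, while the given bulk limit is the Ohm response
`ρ = ρ_b ≥ k − ε` (uniqueness of limits in `𝓝[>] 0`); `R := max R₁ M`. -/
theorem stub_backflowFloor_of_orthogonalOhm :
    Summit.AtomisticToContinuum.FouriersLaw.Theses.HonestZwanzig.FeshbachIdentities →
    (∀ ω₂ lam β γ : ℝ, 0 < ω₂ → 0 < lam → 0 < β → 0 < γ → ∀ T : ℝ, 0 < T → ∀ N : ℕ, 2 ≤ N →
    let P := Literature.MathematicalPhysics.KineticTheory.HeatConduction.pinnedChain ω₂ lam β γ;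
    let X := Literature.MathematicalPhysics.KineticTheory.HeatConduction.PhaseSpace N;
    let μ : MeasureTheory.Measure X := P.gibbsMeasure N T;
    let corr : (X → ℝ) → (X → ℝ) → ℝ → ℝ := fun f g t =>
      (∫ z, f z * (∫ y, g y ∂(P.transitionKernel N T T t.toNNReal z)) ∂μ) - (∫ z, f z ∂μ) * (∫ z, g z ∂μ);
    let lap : ℝ → (X → ℝ) → (X → ℝ) → ℝ := fun s f g =>
      ∫ t in Set.Ioi (0 : ℝ), Real.exp (-(s * t)) * corr f g t;
    let J : X → ℝ := fun z => ∑ i : Fin N, P.bondCurrent N i z;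
    ∀ b : Fin N, b.val + 1 < N →
      Filter.Tendsto (fun s => lap s (P.bondCurrent N b) J) (nhdsWithin (0 : ℝ) (Set.Ioi 0))
        (nhds ((∫ t in Set.Ioi (0 : ℝ), corr J J t) / ((N : ℝ) - 1)))) →
    Summit.AtomisticToContinuum.FouriersLaw.Theses.HonestZwanzig.OrthogonalOhm →
    ∀ ω₂ lam β γ : ℝ, 0 < ω₂ → 0 < lam → 0 < β → 0 < γ → ∀ T : ℝ, 0 < T → ∀ δ : ℝ, 0 < δ → ∃ R : ℕ, ∀ N : ℕ, 2 ≤ N →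
    let P := Literature.MathematicalPhysics.KineticTheory.HeatConduction.pinnedChain ω₂ lam β γ;
    let X := Literature.MathematicalPhysics.KineticTheory.HeatConduction.PhaseSpace N;
    let μ : MeasureTheory.Measure X := P.gibbsMeasure N T;
    let corr : (X → ℝ) → (X → ℝ) → ℝ → ℝ := fun f g t =>
      (∫ z, f z * (∫ y, g y ∂(P.transitionKernel N T T t.toNNReal z)) ∂μ) - (∫ z, f z ∂μ) * (∫ z, g z ∂μ);
    let lap : ℝ → (X → ℝ) → (X → ℝ) → ℝ := fun s f g =>
      ∫ t in Set.Ioi (0 : ℝ), Real.exp (-(s * t)) * corr f g t;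
    let e : Fin N → X → ℝ := fun x z => z.2 x ^ 2 / 2 + P.U (z.1 x) +
      ∑ j : Fin N, ((if j.val = x.val + 1 then P.V (z.1 j - z.1 x) / 2 else 0) +
        (if x.val = j.val + 1 then P.V (z.1 x - z.1 j) / 2 else 0));
    let G : ℝ → Matrix (Fin N) (Fin N) ℝ := fun s => Matrix.of fun x y => lap s (e x) (e y);
    let schur : ℝ → (X → ℝ) → (X → ℝ) → ℝ := fun s f g =>
      lap s f g - ∑ x : Fin N, ∑ y : Fin N, lap s f (e x) * (G s)⁻¹ x y * lap s (e y) g;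
    let J : X → ℝ := fun z => ∑ i : Fin N, P.bondCurrent N i z;
    ∀ b : Fin N, R ≤ b.val → b.val + 2 + R ≤ N → ∀ ρ ℓ : ℝ,
      Filter.Tendsto (fun s => schur s (P.bondCurrent N b) J) (nhdsWithin (0 : ℝ) (Set.Ioi 0)) (nhds ρ) →
      Filter.Tendsto (fun s => lap s (P.bondCurrent N b) J) (nhdsWithin (0 : ℝ) (Set.Ioi 0)) (nhds ℓ) →
      ℓ - δ ≤ ρ := by
  intro hFI hRow hOO ω₂ lam β γ hω hl hβ hγ T hT δ hδ
  obtain ⟨k, C, hkC⟩ := hOO ω₂ lam β γ hω hl hβ hγ T hT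
  -- the orthogonal-dynamics DC responses, chosen once at `ε = δ/4`
  set ε : ℝ := δ / 4 with hε
  have hεpos : 0 < ε := by positivity
  obtain ⟨R₁, hR₁⟩ := hkC ε hεpos
  have hb1 := fun (N : ℕ) (hN : 2 ≤ N) => (hR₁ N hN).1
  choose ρf hρf using hb1
  have hC0 : 0 ≤ C := (abs_nonneg _).trans (hρf 2 le_rfl ⟨0, by norm_num⟩ (by norm_num)).2.1
  set ρ : (N : ℕ) → Fin N → ℝ := fun N b => if h : 2 ≤ N ∧ b.val + 1 < N then ρf N h.1 b h.2 else 0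
    with hρ
  have hρt : ∀ (N : ℕ) (hN : 2 ≤ N) (b : Fin N) (hb : b.val + 1 < N), ρ N b = ρf N hN b hb := by
    intro N hN b hb
    simp only [hρ, dif_pos (And.intro hN hb)]
  have hρ0 : ∀ (N : ℕ) (b : Fin N), ¬ b.val + 1 < N → ρ N b = 0 := by
    intro N b hb
    simp only [hρ]
    rw [dif_neg]
    exact fun h => hb h.2
  -- every response is within `C + |k|` of `k`, the `R₁`-bulk ones within `ε`
  have hall : ∀ N : ℕ, 2 ≤ N → ∀ b : Fin N, |ρ N b - k| ≤ C + |k| := by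
    intro N hN2 b
    by_cases hb : b.val + 1 < N
    · rw [hρt N hN2 b hb]
      have h := (hρf N hN2 b hb).2.1
      calc |ρf N hN2 b hb - k| ≤ |ρf N hN2 b hb| + |k| := abs_sub _ _
        _ ≤ C + |k| := by linarith
    · rw [hρ0 N b hb, zero_sub, abs_neg]
      linarith [abs_nonneg k]
  have hbulk : ∀ N : ℕ, 2 ≤ N → ∀ b : Fin N, R₁ ≤ b.val → b.val + 2 + R₁ ≤ N → |ρ N b - k| ≤ ε := by
    intro N hN2 b h1 h2
    have hb : b.val + 1 < N := by omega
    rw [hρt N hN2 b hb]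
    exact (hρf N hN2 b hb).2.2 h1 h2
  -- hence `Σ_b ρ_b ≤ N k + N ε + (2R₁+1)(C+|k|)` at every `N ≥ 2`
  have hsum : ∀ N : ℕ, 2 ≤ N → ∑ b, ρ N b ≤ N * k + (N * ε + (2 * R₁ + 1) * (C + |k|)) := by
    intro N hN2
    have h1 : ∑ b, ρ N b ≤ ∑ b : Fin N, (k + |ρ N b - k|) :=
      Finset.sum_le_sum fun b _ => by linarith [le_abs_self (ρ N b - k)]
    have h2 : ∑ b : Fin N, (k + |ρ N b - k|) = N * k + ∑ b : Fin N, |ρ N b - k| := by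
      rw [Finset.sum_add_distrib, Finset.sum_const, Finset.card_univ, Fintype.card_fin, nsmul_eq_mul]
    have h3 := sum_abs_le_of_bulk R₁ (fun b : Fin N => ρ N b - k) hεpos.le (by positivity)
      (fun b h1 h2 => hbulk N hN2 b h1 h2) (fun b => hall N hN2 b)
    linarith
  -- the bulk depth: `R₁ ≤ R` and `((2R₁+1)(C+|k|) + |k|)/ε ≤ R`
  obtain ⟨M, hM⟩ := exists_nat_ge (((2 * R₁ + 1) * (C + |k|) + |k|) / ε)
  have hMε : (2 * R₁ + 1) * (C + |k|) + |k| ≤ (M : ℝ) * ε := by rwa [div_le_iff₀ hεpos] at hM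
  refine ⟨max R₁ M, fun N hN => ?_⟩
  intro P X μ corr lap e G schur J b hRb hbN ρ₀ ℓ hρ₀ hℓ
  have hR₁M := le_max_left R₁ M
  have hMR₁ := le_max_right R₁ M
  have hb : b.val + 1 < N := by omega
  have hR₁b : R₁ ≤ b.val := le_trans hR₁M hRb
  have hbR₁ : b.val + 2 + R₁ ≤ N := by omega
  have hMN : M + 2 ≤ N := by omega
  -- (i) Kirchhoff flatness: the unprojected limit is `∫₀^∞corr(J,J)/(N−1)`
  have hrow := hRow ω₂ lam β γ hω hl hβ hγ T hT N hN b hb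
  have hℓeq : ℓ = (∫ t in Set.Ioi (0 : ℝ), corr J J t) / ((N : ℝ) - 1) := tendsto_nhds_unique hℓ hrow
  -- (ii) the given projected limit is the Ohm response, within `ε` of `k`
  have hρeq : ρ₀ = ρf N hN b hb := tendsto_nhds_unique hρ₀ (hρf N hN b hb).1
  have hρk : |ρf N hN b hb - k| ≤ ε := (hρf N hN b hb).2.2 hR₁b hbR₁
  -- (iii) the fixed-`N` upper limit `∫₀^∞corr(J,J) ≤ Σ_b ρ_b`
  have hup : (∫ t in Set.Ioi (0 : ℝ), corr J J t) ≤ ∑ b', ρ N b' :=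
    stub_upperLimit hFI ω₂ lam β γ hω hl hβ hγ T hT N hN (ρ N)
      (fun b' hb' => by rw [hρt N hN b' hb']; exact (hρf N hN b' hb').1) (fun b' hb' => hρ0 N b' hb')
  have hpos : (0 : ℝ) < (N : ℝ) - 1 := by
    have : (2 : ℝ) ≤ N := by exact_mod_cast hN
    linarith
  have hN1 : (M : ℝ) + 1 ≤ (N : ℝ) - 1 := by
    have : ((M + 2 : ℕ) : ℝ) ≤ N := by exact_mod_cast hMN
    push_cast at this
    linarith
  -- so `ℓ ≤ k + 2ε` while `ρ₀ ≥ k − ε`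
  have hk3 : ℓ ≤ k + 2 * ε := by
    rw [hℓeq, div_le_iff₀ hpos]
    have h3 : ((M : ℝ) + 1) * ε ≤ ((N : ℝ) - 1) * ε := mul_le_mul_of_nonneg_right hN1 hεpos.le
    linarith [hup, hsum N hN, le_abs_self k, hMε, h3]
  rw [abs_le] at hρk
  rw [hρeq]
  linarith [hρk.1, hk3, hε, hεpos]

end Summit.AtomisticToContinuum.FouriersLaw.Theorems.HonestZwanzig.PositiveMemory

end
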